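import Mathlib
import Literature.AlgebraicGeometry.Resolution.RsopMonomialIdeals

/-!
# TropicalLinks / InductiveStep — extending a frame by a transversal element

Route `ResolutionOfSingularities/TropicalLinks`, crux `InductiveStep` (stmt-ResolutionOfSingularities-17233),
line `split`, brick FE (producer, stage 4 of `stub_valuativeCharts`).

Setting: `O` is a local ring, `z : Fin r → O` is part of a regular system of parameters of `O`
(`IsRsopPart z`, the local shape of a strict normal crossings boundary: the `zᵢ` are the local
equations of the boundary divisors through the point), and `w ∈ 𝔪` is the local equation of a new
hypersurface section.  Bertini supplies that the section `V(z, w)` of the stratum closure `V(z)` is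
regular at the point, i.e. `O ⧸ (z, w)` is a regular local ring, and generic avoidance supplies that
`w` does not vanish identically on `V(z)`, i.e. `w̄ ≠ 0` in the domain `O ⧸ (z)`.

* `tropicalLinks_isRsopPart_snoc` — **then `(z, w) = Fin.snoc z w` is again part of a regular system
  of parameters of `O`** (the enlarged boundary stays snc at the point).

Proof: the criterion `IsRsopPart.of_isRegularLocalRing_quotient` (Matsumura, Remark after
Thm. 14.2) applied to `Fin.snoc z w`: all members lie in `𝔪`; `range (snoc z w) = range z ∪ {w}`, so
the quotient is the given regular local ring; and for the dimension count, `O ⧸ (z)` is a regular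
local ring (Matsumura 14.2), hence a domain, in which `w̄ ≠ 0` is a non-zero-divisor, so
`dim O⧸(z, w) + 1 ≤ dim O⧸(z)` (`(O⧸(z))⧸(w̄) ≅ O⧸(z, w)`), while `dim O⧸(z) + r = dim O`.
-/

-- single-problem summit: the doubled namespace component `ResolutionOfSingularities` is forced
set_option linter.dupNamespace false

namespace Summit.ResolutionOfSingularities.ResolutionOfSingularities.Theorems

open IsLocalRing Literature.AlgebraicGeometry.Resolution

/-- **Extending a part of a regular system of parameters by a transversal element.** Let `O` be a
local ring, `z : Fin r → O` part of a regular system of parameters, and `w ∈ 𝔪_O` such that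
`O ⧸ (z₁, …, z_r, w)` is a regular local ring and the image of `w` in `O ⧸ (z₁, …, z_r)` is nonzero.
Then `(z₁, …, z_r, w) = Fin.snoc z w` is part of a regular system of parameters of `O`.
(Criterion of Matsumura, Remark after Thm. 14.2, with the dimension count
`dim O⧸(z, w) + 1 ≤ dim O⧸(z) = dim O - r`, the quotient `O ⧸ (z)` being a regular local ring,
hence a domain in which `w̄ ≠ 0` is a non-zero-divisor.) [folklore] -/
theorem tropicalLinks_isRsopPart_snoc :
    ∀ (O : Type) [CommRing O] [IsLocalRing O] (r : ℕ) (z : Fin r → O) (w : O), Literature.AlgebraicGeometry.Resolution.IsRsopPart z → w ∈ IsLocalRing.maximalIdeal O → IsRegularLocalRing (O ⧸ Ideal.span (Set.range z ∪ {w})) → Ideal.Quotient.mk (Ideal.span (Set.range z)) w ≠ 0 → Literature.AlgebraicGeometry.Resolution.IsRsopPart (Fin.snoc z w : Fin (r + 1) → O) := by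
  intro O _ _ r z w hz hw hreg hw0
  haveI := hz.isRegularLocalRing
  -- the ideal of the extended family: `(snoc z w) = (z) ⊔ (w) = (range z ∪ {w})`
  set I : Ideal O := Ideal.span (Set.range z) with hI
  have hrange : Set.range (Fin.snoc z w : Fin (r + 1) → O) = Set.range z ∪ {w} := by
    rw [Fin.range_snoc, Set.union_singleton]
  have hJ : Ideal.span (Set.range (Fin.snoc z w : Fin (r + 1) → O)) = I ⊔ Ideal.span {w} := by
    rw [Fin.range_snoc, Ideal.span_insert, sup_comm]
  have hJ' : Ideal.span (Set.range z ∪ {w}) = I ⊔ Ideal.span {w} := by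
    rw [← hrange, hJ]
  -- (i) all members lie in `𝔪`
  have hzm : ∀ i, (Fin.snoc z w : Fin (r + 1) → O) i ∈ maximalIdeal O := by
    intro i
    induction i using Fin.lastCases with
    | last => rwa [Fin.snoc_last]
    | cast i => rw [Fin.snoc_castSucc]; exact hz.mem_maximalIdeal i
  -- (ii) the quotient by the extended family is the given regular local ring
  haveI hq : IsRegularLocalRing (O ⧸ Ideal.span (Set.range (Fin.snoc z w : Fin (r + 1) → O))) :=
    IsRegularLocalRing.of_ringEquiv (R := O ⧸ Ideal.span (Set.range z ∪ {w}))
      (Ideal.quotEquivOfEq (hJ'.trans hJ.symm))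
  -- (iii) the dimension count
  refine IsRsopPart.of_isRegularLocalRing_quotient hzm ?_
  haveI := hz.isRegularLocalRing_quotient
  haveI : IsDomain (O ⧸ I) := isDomain_of_isRegularLocalRing _
  -- `dim O⧸((z) ⊔ (w)) + 1 ≤ dim O⧸(z)`: `w̄` is a non-zero-divisor of the domain `O ⧸ (z)`
  have h1 : ringKrullDim (O ⧸ (I ⊔ Ideal.span {w})) + 1 ≤ ringKrullDim (O ⧸ I) := by
    have hnzd : Ideal.Quotient.mk I w ∈ nonZeroDivisors (O ⧸ I) := mem_nonZeroDivisors_of_ne_zero hw0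
    have h := ringKrullDim_quotient_succ_le_of_nonZeroDivisor hnzd
    have heq : Ideal.span {Ideal.Quotient.mk I w} = (Ideal.span {w}).map (Ideal.Quotient.mk I) := by
      rw [Ideal.map_span, Set.image_singleton]
    have e : (O ⧸ I) ⧸ Ideal.span {Ideal.Quotient.mk I w} ≃+* O ⧸ (I ⊔ Ideal.span {w}) :=
      (Ideal.quotEquivOfEq heq).trans (DoubleQuot.quotQuotEquivQuotSup I (Ideal.span {w}))
    rwa [ringKrullDim_eq_of_ringEquiv e] at h
  -- `dim O⧸(z) + r = dim O`
  have h2 : ringKrullDim (O ⧸ I) + r = ringKrullDim O := hz.ringKrullDim_quotient_add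
  rw [ringKrullDim_eq_of_ringEquiv (Ideal.quotEquivOfEq hJ), ← h2]
  calc ringKrullDim (O ⧸ (I ⊔ Ideal.span {w})) + ((r + 1 : ℕ) : WithBot ℕ∞)
      = ringKrullDim (O ⧸ (I ⊔ Ideal.span {w})) + 1 + r := by
        push_cast
        rw [add_comm (r : WithBot ℕ∞) 1, add_assoc]
    _ ≤ ringKrullDim (O ⧸ I) + r := add_le_add h1 le_rfl

end Summit.ResolutionOfSingularities.ResolutionOfSingularities.Theorems
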